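import Summits.QuantumFields.BalabanUV.T4Continuum.Support.NE3BlockMeanExactInterpolant
import HarnessLib

/-!
# T⁴ programme, node NE3 — row E-MLw-(w4)-P-curved, row K5 (K5b-3a): the block-mean-exact interpolant, LOCAL form — the coboundary on
# ONE block is controlled by the datum's differences on the unit cube above the block's corner

NE3 (node U1b) formalisation swarm, leaf seat `b2b-balaban-t4-ne3-formalise-leaf-01` (gen 5); row **K5** of ruling ρ-g22-2 (holder
leaf-01-g5), design `HOME/b2b-balaban-t4-ne3-formalise-leaf-01/g5/K5b-DESIGN.md`.  K5a (`NE3BlockMeanExactInterpolant` p228188) states the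
energy bound GLOBALLY for one periodic datum; the covariant interpolant of K5b uses a DIFFERENT datum on every block (`NE3CoarseFrameData.frameData
U m z`, p228922), so the END needs the bound BLOCK BY BLOCK.  THIS FILE ([folklore]; 0 sorry; one DATA def `cubeEnergy`):
* `cubeEnergy m z := Σ_{S ⊆ univ} Σ_i ‖dPot m (z + indic S) i‖²` — the datum's squared differences on the edges issuing from the `2^d`
  vertices of the unit cube above `z`;
* `norm_vertex_sub_le` ∕ **`normSq_vertex_sub_le_cube`** — `‖m (z + indic T) − m z‖² ≤ 2^d·d·cubeEnergy m z` (a monotone lattice path, Cauchy–Schwarz);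
* **`normSq_bmeCoef_le_local`** — `‖bmeCoef M m z‖² ≤ d·256^d·cubeEnergy m z` (`M ≥ 2`);
* **`normSq_dPot_bmeInterp_le_local`** — for every fine site `y`: `‖dPot (bmeInterp M m) y α‖² ≤ (2 + 2·d·256^d)·M⁻²·cubeEnergy m (blk M y)`;
* **`sum_block_normSq_dPot_bmeInterp_le`** — `Σ_{v∈[0,M)^d} Σ_α ‖dPot (bmeInterp M m) (M•z + v) α‖² ≤ (2d + 2d²·256^d)·(M^d∕M²)·cubeEnergy m z`.

HONEST FRAMING.  Pure lattice calculus; nothing about Bałaban's minimisers; (P♮)∕(ML_w) at W ≠ 1, T-E_w and **NE3 are NOT proved**; spine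
PROVED 0∕9; finite T⁴ rung (B)+1 — NOT infinite volume, NOT mass gap, NOT `BetaPertH`, NOT Clay.  PLACEMENT: `Summits/QuantumFields/BalabanUV/`.
HONEST DEPENDENCY (cell page 1): continuum YM on T⁴ ⇐ BetaPertH ∧ nine spine estimates (0/9 proved); BetaPertH ⇐ (D1) ∧ (D4) ∧ CAP+tail;
G-an2-4 gates asym, D1 and NE2/3/4.
-/

set_option autoImplicit false

open scoped BigOperators
open Finset

namespace Summit.QuantumFields.BalabanUV.T4Continuum.NE3BlockMeanExactLocal

open Literature.MathematicalPhysics.QuantumFieldTheory.Balaban1983to89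
open B7Prop1Explicit
open T4AveragingDeficitWallBoundary (periodBox mem_periodBox card_periodBox)
open SmoothRefineBlocks (blk)
open SmoothRefineInterp (indic indic_insert cfd interp)
open NE3TangentNoGoWords (dPot)
open NE3CoarseInterpolant (dPot_interp normSq_interp_le blk_block)
open NE3TentBump (tentSum tentSum_pos le_tentSum bump norm_dPot_bump_le)
open NE3BlockMeanExactInterpolant (bmeCoef bmeInterp normSq_interp_sub_le normSq_sum_le_card_mul)

noncomputable section

variable {d : ℕ}
variable {𝔸 : Type*} [NormedRing 𝔸] [NormedSpace ℝ 𝔸]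

/-! ## §1 The cube energy and vertex increments -/

omit [NormedSpace ℝ 𝔸] in
/-- THE CUBE ENERGY of the datum at `z`: squared differences on all edges issuing from the vertices of the unit cube above `z`. [folklore] -/
def cubeEnergy (m : Site d → 𝔸) (z : Site d) : ℝ :=
  ∑ S ∈ (Finset.univ : Finset (Fin d)).powerset, ∑ i : Fin d, ‖dPot m (z + indic S) i‖ ^ 2

omit [NormedSpace ℝ 𝔸] in
/-- `0 ≤ cubeEnergy`. [folklore] -/
theorem cubeEnergy_nonneg (m : Site d → 𝔸) (z : Site d) : 0 ≤ cubeEnergy m z :=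
  Finset.sum_nonneg fun _ _ => Finset.sum_nonneg fun _ _ => sq_nonneg _

omit [NormedSpace ℝ 𝔸] in
/-- A vertex increment is bounded by the edge differences inside its sub-cube (a monotone lattice path, ℓ¹ form):
`‖m (z + indic T) − m z‖ ≤ Σ_{S ⊆ T} Σ_{i ∈ T} ‖dPot m (z + indic S) i‖`. [folklore] -/
theorem norm_vertex_sub_le (m : Site d → 𝔸) (z : Site d) (T : Finset (Fin d)) :
    ‖m (z + indic T) - m z‖ ≤ ∑ S ∈ T.powerset, ∑ i ∈ T, ‖dPot m (z + indic S) i‖ := by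
  induction T using Finset.induction_on with
  | empty => simp
  | insert i T hi ih =>
    have hsplit : m (z + indic (insert i T)) - m z = dPot m (z + indic T) i + (m (z + indic T) - m z) := by
      rw [indic_insert hi]; simp only [dPot]; abel_nf
    rw [hsplit]
    refine (norm_add_le _ _).trans ?_
    -- the target sum contains the new edge `(T, i)` and all old terms
    have hsub : T.powerset ⊆ (insert i T).powerset := Finset.powerset_mono.mpr (Finset.subset_insert i T)
    have hnn : ∀ S ∈ (insert i T).powerset, 0 ≤ ∑ i' ∈ insert i T, ‖dPot m (z + indic S) i'‖ :=
      fun S _ => Finset.sum_nonneg fun _ _ => norm_nonneg _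
    calc ‖dPot m (z + indic T) i‖ + ‖m (z + indic T) - m z‖
        ≤ ‖dPot m (z + indic T) i‖ + ∑ S ∈ T.powerset, ∑ i' ∈ T, ‖dPot m (z + indic S) i'‖ := add_le_add le_rfl ih
      _ ≤ ∑ S ∈ T.powerset, ∑ i' ∈ insert i T, ‖dPot m (z + indic S) i'‖ := by
          rw [Finset.sum_congr rfl fun S _ => Finset.sum_insert hi, Finset.sum_add_distrib]
          refine add_le_add ?_ le_rfl
          exact Finset.single_le_sum (f := fun S => ‖dPot m (z + indic S) i‖) (fun S _ => norm_nonneg _)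
            (Finset.mem_powerset_self T)
      _ ≤ ∑ S ∈ (insert i T).powerset, ∑ i' ∈ insert i T, ‖dPot m (z + indic S) i'‖ :=
          Finset.sum_le_sum_of_subset_of_nonneg hsub fun S hS _ => hnn S hS

omit [NormedSpace ℝ 𝔸] in
/-- **VERTEX INCREMENTS AGAINST THE CUBE ENERGY**: `‖m (z + indic T) − m z‖² ≤ 2^d·d·cubeEnergy m z`. [folklore] -/
theorem normSq_vertex_sub_le_cube (m : Site d → 𝔸) (z : Site d) (T : Finset (Fin d)) :
    ‖m (z + indic T) - m z‖ ^ 2 ≤ (2 : ℝ) ^ d * d * cubeEnergy m z := by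
  have h1 := norm_vertex_sub_le m z T
  -- Cauchy–Schwarz over the index set `T.powerset ×ˢ T`
  have h2 : (∑ S ∈ T.powerset, ∑ i ∈ T, ‖dPot m (z + indic S) i‖) ^ 2
      ≤ ((T.powerset ×ˢ T).card : ℝ) * ∑ p ∈ T.powerset ×ˢ T, ‖dPot m (z + indic p.1) p.2‖ ^ 2 := by
    rw [← Finset.sum_product (s := T.powerset) (t := T) (f := fun p => ‖dPot m (z + indic p.1) p.2‖)]
    exact sq_sum_le_card_mul_sum_sq
  have hcard : ((T.powerset ×ˢ T).card : ℝ) ≤ (2 : ℝ) ^ d * d := by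
    rw [Finset.card_product, Finset.card_powerset]
    have hT : T.card ≤ d := by simpa using Finset.card_le_univ T
    have h3 : (2 : ℝ) ^ T.card ≤ (2 : ℝ) ^ d := pow_le_pow_right₀ (by norm_num) hT
    push_cast
    exact mul_le_mul h3 (by exact_mod_cast hT) (by positivity) (by positivity)
  have hsub : ∑ p ∈ T.powerset ×ˢ T, ‖dPot m (z + indic p.1) p.2‖ ^ 2 ≤ cubeEnergy m z := by
    rw [Finset.sum_product]
    unfold cubeEnergy
    refine (Finset.sum_le_sum_of_subset_of_nonneg (Finset.powerset_mono.mpr (Finset.subset_univ T)) fun S _ _ =>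
      Finset.sum_nonneg fun _ _ => sq_nonneg _).trans (Finset.sum_le_sum fun S _ => ?_)
    exact Finset.sum_le_sum_of_subset_of_nonneg (Finset.subset_univ T) fun i _ _ => sq_nonneg _
  have hE := cubeEnergy_nonneg m z
  calc ‖m (z + indic T) - m z‖ ^ 2 ≤ (∑ S ∈ T.powerset, ∑ i ∈ T, ‖dPot m (z + indic S) i‖) ^ 2 :=
        pow_le_pow_left₀ (norm_nonneg _) h1 2
    _ ≤ ((T.powerset ×ˢ T).card : ℝ) * ∑ p ∈ T.powerset ×ˢ T, ‖dPot m (z + indic p.1) p.2‖ ^ 2 := h2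
    _ ≤ (2 : ℝ) ^ d * d * cubeEnergy m z :=
        mul_le_mul hcard hsub (Finset.sum_nonneg fun _ _ => sq_nonneg _) (by positivity)

/-! ## §2 The mean-correction coefficient, locally -/

/-- **LOCAL COST OF THE MEAN CORRECTION**: `‖bmeCoef M m z‖² ≤ d·256^d·cubeEnergy m z` (`M ≥ 2`). [folklore] -/
theorem normSq_bmeCoef_le_local {M : ℕ} (hM : 2 ≤ M) (m : Site d → 𝔸) (z : Site d) :
    ‖bmeCoef M m z‖ ^ 2 ≤ (d : ℝ) * (256 : ℝ) ^ d * cubeEnergy m z := by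
  have hM1 : 1 ≤ M := by omega
  have hM0 : (0 : ℝ) < M := by exact_mod_cast (by omega : 0 < M)
  have hTS := tentSum_pos hM d
  have hTSle := le_tentSum hM d
  have hE := cubeEnergy_nonneg m z
  -- `‖c_z‖² ≤ tentSum⁻²·M^d·Σ_v Σ_T ‖m(z+1_T) − m z‖²`
  have hpt : ‖bmeCoef M m z‖ ^ 2
      ≤ (tentSum d M)⁻¹ ^ 2 * ((M : ℝ) ^ d * ∑ v ∈ periodBox (d := d) M,
          ∑ T ∈ (Finset.univ : Finset (Fin d)).powerset, ‖m (z + indic T) - m z‖ ^ 2) := by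
    unfold bmeCoef
    rw [norm_smul, mul_pow, Real.norm_of_nonneg (inv_nonneg.mpr hTS.le)]
    refine mul_le_mul_of_nonneg_left ?_ (by positivity)
    have h1 := normSq_sum_le_card_mul (periodBox (d := d) M) (fun v => m z - interp M Finset.univ m ((M : ℤ) • z + v))
    rw [card_periodBox] at h1
    push_cast at h1
    refine h1.trans (mul_le_mul_of_nonneg_left (Finset.sum_le_sum fun v hv => ?_) (by positivity))
    rw [norm_sub_rev]
    have h2 := normSq_interp_sub_le hM1 Finset.univ m ((M : ℤ) • z + v)
    rw [blk_block hM1 z hv] at h2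
    exact h2
  have hpow : ((Finset.univ : Finset (Fin d)).powerset.card : ℝ) = (2 : ℝ) ^ d := by
    rw [Finset.card_powerset, Finset.card_univ, Fintype.card_fin]; push_cast; ring
  have hinner : ∑ v ∈ periodBox (d := d) M, ∑ T ∈ (Finset.univ : Finset (Fin d)).powerset, ‖m (z + indic T) - m z‖ ^ 2
      ≤ (M : ℝ) ^ d * ((2 : ℝ) ^ d * ((2 : ℝ) ^ d * d * cubeEnergy m z)) := by
    calc ∑ v ∈ periodBox (d := d) M, ∑ T ∈ (Finset.univ : Finset (Fin d)).powerset, ‖m (z + indic T) - m z‖ ^ 2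
        ≤ ∑ v ∈ periodBox (d := d) M, ∑ T ∈ (Finset.univ : Finset (Fin d)).powerset, (2 : ℝ) ^ d * d * cubeEnergy m z :=
          Finset.sum_le_sum fun v _ => Finset.sum_le_sum fun T _ => normSq_vertex_sub_le_cube m z T
      _ = (M : ℝ) ^ d * ((2 : ℝ) ^ d * ((2 : ℝ) ^ d * d * cubeEnergy m z)) := by
          rw [Finset.sum_const, Finset.sum_const, card_periodBox, nsmul_eq_mul, nsmul_eq_mul, hpow]
          push_cast; ring
  have h256 : ((8 : ℝ) ^ d) ^ 2 * ((2 : ℝ) ^ d * (2 : ℝ) ^ d) = (256 : ℝ) ^ d := by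
    rw [sq, ← mul_pow, ← mul_pow, ← mul_pow]; norm_num
  have hq : (M : ℝ) ^ d * (tentSum d M)⁻¹ ≤ (8 : ℝ) ^ d := by
    rw [← div_eq_mul_inv, div_le_iff₀ hTS]
    calc (M : ℝ) ^ d = (8 : ℝ) ^ d * ((M : ℝ) / 8) ^ d := by rw [← mul_pow]; congr 1; ring
      _ ≤ (8 : ℝ) ^ d * tentSum d M := mul_le_mul_of_nonneg_left hTSle (by positivity)
  have hq0 : 0 ≤ (M : ℝ) ^ d * (tentSum d M)⁻¹ := by positivity
  calc ‖bmeCoef M m z‖ ^ 2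
      ≤ (tentSum d M)⁻¹ ^ 2 * ((M : ℝ) ^ d * ((M : ℝ) ^ d * ((2 : ℝ) ^ d * ((2 : ℝ) ^ d * d * cubeEnergy m z)))) :=
        hpt.trans (mul_le_mul_of_nonneg_left (mul_le_mul_of_nonneg_left hinner (by positivity)) (by positivity))
    _ = ((M : ℝ) ^ d * (tentSum d M)⁻¹) ^ 2 * ((2 : ℝ) ^ d * ((2 : ℝ) ^ d * d * cubeEnergy m z)) := by ring
    _ ≤ ((8 : ℝ) ^ d) ^ 2 * ((2 : ℝ) ^ d * ((2 : ℝ) ^ d * d * cubeEnergy m z)) := by gcongr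
    _ = (d : ℝ) * (256 : ℝ) ^ d * cubeEnergy m z := by rw [← h256]; ring

/-! ## §3 The pointwise and the one-block bounds -/

/-- **POINTWISE**: `‖dPot (bmeInterp M m) y α‖² ≤ (2 + 2·d·256^d)·M⁻²·cubeEnergy m (blk M y)` (`M ≥ 2`; valid at every fine site, face bonds
included — the interpolant's difference formula and the bump bound both read the block of `y`). [folklore] -/
theorem normSq_dPot_bmeInterp_le_local {M : ℕ} (hM : 2 ≤ M) (m : Site d → 𝔸) (y : Site d) (α : Fin d) :
    ‖dPot (bmeInterp M m) y α‖ ^ 2 ≤ (2 + 2 * (d : ℝ) * (256 : ℝ) ^ d) * (1 / (M : ℝ) ^ 2) * cubeEnergy m (blk M y) := by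
  have hM1 : 1 ≤ M := by omega
  have hM0 : (0 : ℝ) < M := by exact_mod_cast (by omega : 0 < M)
  set z := blk M y with hz
  have hE := cubeEnergy_nonneg m z
  -- split interpolant + bump
  have hsplit : dPot (bmeInterp M m) y α = dPot (interp M Finset.univ m) y α + dPot (bump M (bmeCoef M m)) y α := by
    simp only [dPot, bmeInterp]; abel
  -- interpolant part: `(1∕M)²·Σ_{T ⊆ univ∖α} ‖dPot m (z + 1_T) α‖² ≤ M⁻²·cubeEnergy`
  have hI : ‖dPot (interp M Finset.univ m) y α‖ ^ 2 ≤ (1 / (M : ℝ) ^ 2) * cubeEnergy m z := by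
    rw [dPot_interp hM1 m y α, norm_smul, mul_pow, Real.norm_of_nonneg (by positivity), one_div, inv_pow, ← one_div]
    refine mul_le_mul_of_nonneg_left ?_ (by positivity)
    refine (normSq_interp_le hM1 _ (cfd α m) y).trans ?_
    rw [← hz]
    unfold cubeEnergy
    refine (Finset.sum_le_sum_of_subset_of_nonneg (Finset.powerset_mono.mpr (Finset.subset_univ _)) fun S _ _ => sq_nonneg _).trans
      (Finset.sum_le_sum fun S _ => ?_)
    exact Finset.single_le_sum (f := fun i => ‖dPot m (z + indic S) i‖ ^ 2) (fun i _ => sq_nonneg _) (Finset.mem_univ α)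
  -- bump part: `(1∕M)²·‖c_z‖² ≤ M⁻²·d·256^d·cubeEnergy`
  have hB : ‖dPot (bump M (bmeCoef M m)) y α‖ ^ 2 ≤ (1 / (M : ℝ) ^ 2) * ((d : ℝ) * (256 : ℝ) ^ d * cubeEnergy m z) := by
    have h := norm_dPot_bump_le hM1 (bmeCoef M m) y α
    rw [← hz] at h
    calc ‖dPot (bump M (bmeCoef M m)) y α‖ ^ 2 ≤ ((1 / (M : ℝ)) * ‖bmeCoef M m z‖) ^ 2 := pow_le_pow_left₀ (norm_nonneg _) h 2
      _ = (1 / (M : ℝ) ^ 2) * ‖bmeCoef M m z‖ ^ 2 := by ring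
      _ ≤ (1 / (M : ℝ) ^ 2) * ((d : ℝ) * (256 : ℝ) ^ d * cubeEnergy m z) :=
          mul_le_mul_of_nonneg_left (normSq_bmeCoef_le_local hM m z) (by positivity)
  rw [hsplit]
  have h := norm_add_le (dPot (interp M Finset.univ m) y α) (dPot (bump M (bmeCoef M m)) y α)
  have hsq : ‖dPot (interp M Finset.univ m) y α + dPot (bump M (bmeCoef M m)) y α‖ ^ 2
      ≤ 2 * ‖dPot (interp M Finset.univ m) y α‖ ^ 2 + 2 * ‖dPot (bump M (bmeCoef M m)) y α‖ ^ 2 := by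
    nlinarith [sq_nonneg (‖dPot (interp M Finset.univ m) y α‖ - ‖dPot (bump M (bmeCoef M m)) y α‖), norm_nonneg (dPot (interp M Finset.univ m) y α),
      norm_nonneg (dPot (bump M (bmeCoef M m)) y α), norm_nonneg (dPot (interp M Finset.univ m) y α + dPot (bump M (bmeCoef M m)) y α)]
  calc _ ≤ 2 * ‖dPot (interp M Finset.univ m) y α‖ ^ 2 + 2 * ‖dPot (bump M (bmeCoef M m)) y α‖ ^ 2 := hsq
    _ ≤ 2 * ((1 / (M : ℝ) ^ 2) * cubeEnergy m z) + 2 * ((1 / (M : ℝ) ^ 2) * ((d : ℝ) * (256 : ℝ) ^ d * cubeEnergy m z)) := by gcongr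
    _ = (2 + 2 * (d : ℝ) * (256 : ℝ) ^ d) * (1 / (M : ℝ) ^ 2) * cubeEnergy m z := by ring

/-- **ONE BLOCK**: `Σ_{v∈[0,M)^d} Σ_α ‖dPot (bmeInterp M m) (M•z + v) α‖² ≤ (2d + 2d²·256^d)·(M^d∕M²)·cubeEnergy m z` (`M ≥ 2`). [folklore] -/
theorem sum_block_normSq_dPot_bmeInterp_le {M : ℕ} (hM : 2 ≤ M) (m : Site d → 𝔸) (z : Site d) :
    ∑ v ∈ periodBox (d := d) M, ∑ α : Fin d, ‖dPot (bmeInterp M m) ((M : ℤ) • z + v) α‖ ^ 2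
      ≤ (2 * (d : ℝ) + 2 * (d : ℝ) ^ 2 * (256 : ℝ) ^ d) * ((M : ℝ) ^ d / (M : ℝ) ^ 2) * cubeEnergy m z := by
  have hM1 : 1 ≤ M := by omega
  have hM0 : (0 : ℝ) < M := by exact_mod_cast (by omega : 0 < M)
  calc ∑ v ∈ periodBox (d := d) M, ∑ α : Fin d, ‖dPot (bmeInterp M m) ((M : ℤ) • z + v) α‖ ^ 2
      ≤ ∑ v ∈ periodBox (d := d) M, ∑ _α : Fin d, (2 + 2 * (d : ℝ) * (256 : ℝ) ^ d) * (1 / (M : ℝ) ^ 2) * cubeEnergy m z := by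
        refine Finset.sum_le_sum fun v hv => Finset.sum_le_sum fun α _ => ?_
        have h := normSq_dPot_bmeInterp_le_local hM m ((M : ℤ) • z + v) α
        rwa [blk_block hM1 z hv] at h
    _ = (2 * (d : ℝ) + 2 * (d : ℝ) ^ 2 * (256 : ℝ) ^ d) * ((M : ℝ) ^ d / (M : ℝ) ^ 2) * cubeEnergy m z := by
        simp only [Finset.sum_const, Finset.card_univ, Fintype.card_fin, card_periodBox, nsmul_eq_mul]
        push_cast
        field_simp

end

end Summit.QuantumFields.BalabanUV.T4Continuum.NE3BlockMeanExactLocal
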